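import Summits.AtomisticToContinuum.Crystallization.Theorems.PalmUnimodularRigidityMinimiserShellsQualShellNoBoundaryOfPeriodicShellGap

/-!
# The hard-core periodic shell gap gives the hard-core qualitative no-boundary shell gap (stub S16, reshape r6)

Stub `stub_sepQualShellNoBoundary_of_sepPeriodicShellGap` (S16) of line `equilibrium-in-law-surgery`
(reshape r6) of crux `MinimiserShells` (stmt-AtomisticToContinuum-9225, route `PalmUnimodularRigidity`).

This is the `1/3`-hard-core version of stub S13
(`PeriodicShellGap.stub_qualShellNoBoundary_of_periodicShellGap`, file
`PalmUnimodularRigidityMinimiserShellsQualShellNoBoundaryOfPeriodicShellGap`).  If the periodic shell gap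
holds for `1/3`-SEPARATED periodic configurations — for every threshold `t > 0` some `κ > 0` such that
every periodic configuration `Q` of `ℝ³` whose point set is `1/3`-separated and which has at least
`t · #motif` motif sites badly shelled in `Q.points` has `e* + κ ≤ e(Q)` — then the qualitative
particle-level no-boundary shell gap holds for `1/3`-SEPARATED finite configurations, with the same `κ`
for each `t`: every finite injective `1/3`-separated `y : Fin N → ℝ³` with at least `t · N` badly-shelled
sites has `N · (e* + κ) ≤ 𝓔_N(y)`.

Proof.  As for S13 (`N = 0` is `0 ≤ 0`; for `N ≥ 1` periodise `y` with the cubic lattice of period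
`2Σ‖yᵢ‖ + 2`, `ChargedEnergyGapNegative.periodise`; badly-shelled indices of `y` inject into badly-shelled
motif sites, `PeriodicShellGap.natCard_bad_le_natCard_badMotif_periodise`; and
`e(Q) ≤ 𝓔_N(y) / N`, `energyPerParticle_periodise_le`), with one new ingredient: the hard core passes
to the periodisation (`le_dist_of_mem_points_periodise`).  Two distinct points `yⱼ + g`, `y_k + g'` of the
periodisation are, after the common translation by `-g`, the motif point `yⱼ` and the point
`y_k + (g' - g)`, which is either some `y_l` with `l ≠ j` (distance `≥ 1/3` by the hypothesis on `y`) or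
not one of the `y_l` (distance `≥ 2 ≥ 1/3`, `two_le_dist_of_mem_points`).
-/

noncomputable section

open MeasureTheory
open scoped ENNReal BigOperators Classical

namespace Summit.AtomisticToContinuum.Crystallization.Theorems.PalmUnimodularRigidityMinimiserShells.SepPeriodicShellGap

open Literature.MathematicalPhysics.StatisticalMechanics (lennardJones interactionEnergy PeriodicConfiguration)
open Summit.AtomisticToContinuum.Crystallization.Theorems.MinimiserShells.Negative.LoadBearing (eStar GoodShell)
open Summit.AtomisticToContinuum.Crystallization.Theorems.MinimiserShells.Negative.Rootedness (E3)
open Summit.AtomisticToContinuum.Crystallization.Theorems.ChargedEnergyGapNegative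
  (periodise periodUnit motif_periodise two_le_dist_of_mem_points energyPerParticle_periodise_le)
open Summit.AtomisticToContinuum.Crystallization.Theorems.PalmUnimodularRigidityMinimiserShells.PeriodicShellGap
  (natCard_bad_le_natCard_badMotif_periodise)

variable {N : ℕ}

/-! ## The hard core passes to the periodisation -/

-- adapted from `LayerConfined.le_dist_of_mem_points_periodise`
-- (Theorems/ChessboardParticlePlanesLayerConfinedCompetitorsPeriodisation.lean), restated here to keep the
-- route's import closure free of the `ChessboardParticlePlanes` thesis.
/-- **All points of the cubic periodisation are separated.**  If the configuration `y` (`N ≥ 1` points)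
is `δ`-separated with `δ ≤ 2`, then so is the point set of its periodisation `periodise y` (cubic lattice
of period `2Σ‖yᵢ‖ + 2`): a pair of distinct points is, up to a common period, a motif point `yⱼ` and
another point, which is either another `y_l` (distance `≥ δ`) or a far image (distance `≥ 2`,
`two_le_dist_of_mem_points`). -/
theorem le_dist_of_mem_points_periodise {y : Fin N → E3} (hN : 0 < N) {δ : ℝ} (hδ2 : δ ≤ 2)
    (hsep : ∀ j k : Fin N, j ≠ k → δ ≤ dist (y j) (y k)) {p q : E3}
    (hp : p ∈ (periodise y (periodUnit y) le_rfl hN).points)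
    (hq : q ∈ (periodise y (periodUnit y) le_rfl hN).points) (hpq : p ≠ q) : δ ≤ dist p q := by
  set P := periodise y (periodUnit y) le_rfl hN with hP
  obtain ⟨z, hz, g, hg, rfl⟩ := hp
  obtain ⟨z', hz', g', hg', rfl⟩ := hq
  rw [hP, motif_periodise] at hz hz'
  obtain ⟨j, -, rfl⟩ := Finset.mem_image.1 hz
  obtain ⟨k, -, rfl⟩ := Finset.mem_image.1 hz'
  have hmem : y k + (g' - g) ∈ P.points :=
    P.add_mem_points (P.mem_points_of_mem_motif (by
      rw [hP, motif_periodise]; exact Finset.mem_image_of_mem y (Finset.mem_univ k)))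
      (P.lattice.sub_mem hg' hg)
  have hdist : dist (y j + g) (y k + g') = dist (y j) (y k + (g' - g)) := by
    rw [dist_eq_norm, dist_eq_norm]
    congr 1
    abel
  rw [hdist]
  by_cases hex : ∃ l, y k + (g' - g) = y l
  · obtain ⟨l, hl⟩ := hex
    rw [hl]
    refine hsep j l ?_
    rintro rfl
    apply hpq
    have : y k + g' = y j + g := by
      rw [← hl]
      abel
    rw [this]
  · push Not at hex
    exact hδ2.trans (two_le_dist_of_mem_points y (periodUnit y) le_rfl hN j hmem hex)

/-- **The `1/3`-hard core passes to the periodisation**: if `y` is `1/3`-separated then so is the point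
set of `periodise y` (`le_dist_of_mem_points_periodise` with `δ = 1/3 ≤ 2`). -/
theorem third_le_dist_of_mem_points_periodise {y : Fin N → E3} (hN : 0 < N)
    (hsep : ∀ i j : Fin N, i ≠ j → (1 : ℝ) / 3 ≤ dist (y i) (y j)) :
    ∀ p ∈ (periodise y (periodUnit y) le_rfl hN).points,
      ∀ q ∈ (periodise y (periodUnit y) le_rfl hN).points, p ≠ q → (1 : ℝ) / 3 ≤ dist p q :=
  fun _ hp _ hq hpq => le_dist_of_mem_points_periodise hN (by norm_num) hsep hp hq hpq

/-! ## The stub -/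

/-- **Stub `stub_sepQualShellNoBoundary_of_sepPeriodicShellGap` (S16) of line `equilibrium-in-law-surgery`.**
The hard-core periodic shell gap (`1/3`-separated periodic configurations with at least `t · #motif` motif
sites badly shelled in `Q.points` have `e* + κ ≤ e(Q)`) implies the hard-core qualitative particle-level
no-boundary shell gap (finite injective `1/3`-separated configurations with at least `t · N` badly-shelled
sites have `N · (e* + κ) ≤ 𝓔_N`), with the same `κ` for each `t`: periodise `y` with the cubic lattice of
period `2Σ‖yᵢ‖ + 2`; the periodisation is again `1/3`-separated
(`third_le_dist_of_mem_points_periodise`); motif shells read in the periodic point set are the shells of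
`y`, so `#bad motif ≥ #bad(y) ≥ t · N = t · #motif` (`natCard_bad_le_natCard_badMotif_periodise`); and
`e(Q) ≤ 𝓔_N(y) / N` (`energyPerParticle_periodise_le`). -/
theorem stub_sepQualShellNoBoundary_of_sepPeriodicShellGap :
    (∀ t : ℝ, 0 < t → ∃ κ : ℝ, 0 < κ ∧
      ∀ Q : Literature.MathematicalPhysics.StatisticalMechanics.PeriodicConfiguration 3,
        (∀ p ∈ Q.points, ∀ q ∈ Q.points, p ≠ q → (1 : ℝ) / 3 ≤ dist p q) →
        t * (Q.motif.card : ℝ) ≤ (Nat.card {x : Q.motif // ¬ GoodShell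
            ((Measure.count : Measure (EuclideanSpace ℝ (Fin 3))).restrict
              ((fun z => z - (x : EuclideanSpace ℝ (Fin 3))) '' Q.points))} : ℝ) →
        eStar + κ ≤ Q.energyPerParticle lennardJones) →
    ∀ t : ℝ, 0 < t → ∃ κ : ℝ, 0 < κ ∧ ∀ (N : ℕ) (y : Fin N → EuclideanSpace ℝ (Fin 3)), Function.Injective y →
      (∀ i j : Fin N, i ≠ j → (1 : ℝ) / 3 ≤ dist (y i) (y j)) →
      t * (N : ℝ) ≤ (Nat.card {i : Fin N // ¬ GoodShell
          ((Measure.count : Measure (EuclideanSpace ℝ (Fin 3))).restrict ((fun z => z - y i) '' Set.range y))} : ℝ) →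
      (N : ℝ) * (eStar + κ) ≤ interactionEnergy lennardJones y := by
  intro hper t ht
  obtain ⟨κ, hκ, hQ⟩ := hper t ht
  refine ⟨κ, hκ, fun N y hy hsep hbad => ?_⟩
  rcases Nat.eq_zero_or_pos N with rfl | hN
  · simp [interactionEnergy]
  · set Q := periodise y (periodUnit y) le_rfl hN with hQdef
    have hcard : Q.motif.card = N := by
      rw [hQdef, motif_periodise, Finset.card_image_of_injective _ hy, Finset.card_univ,
        Fintype.card_fin]
    have hle := natCard_bad_le_natCard_badMotif_periodise hy hN
    have hthr : t * (Q.motif.card : ℝ) ≤ (Nat.card {x : Q.motif // ¬ GoodShell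
        ((Measure.count : Measure E3).restrict ((fun z => z - (x : E3)) '' Q.points))} : ℝ) := by
      rw [hcard]
      exact hbad.trans (by exact_mod_cast hle)
    have hQsep : ∀ p ∈ Q.points, ∀ q ∈ Q.points, p ≠ q → (1 : ℝ) / 3 ≤ dist p q :=
      third_le_dist_of_mem_points_periodise hN hsep
    have h1 : eStar + κ ≤ Q.energyPerParticle lennardJones := hQ Q hQsep hthr
    have h2 : Q.energyPerParticle lennardJones ≤ interactionEnergy lennardJones y / N :=
      energyPerParticle_periodise_le hy (periodUnit y) le_rfl hN
    have hNr : (0 : ℝ) < N := by exact_mod_cast hN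
    have h3 := h1.trans h2
    rwa [le_div_iff₀ hNr, mul_comm] at h3

end Summit.AtomisticToContinuum.Crystallization.Theorems.PalmUnimodularRigidityMinimiserShells.SepPeriodicShellGap

end
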